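import Literature.Combinatorics.Additive.StevensDeZeeuwIncidence
import Mathlib.Algebra.BigOperators.Group.Finset.Piecewise
import Mathlib.Algebra.BigOperators.Group.Finset.Sigma
import Mathlib.Algebra.BigOperators.Ring.Finset
import Mathlib.Algebra.Order.Chebyshev
import Mathlib.Algebra.Order.Floor.Defs
import Mathlib.Algebra.Order.Floor.Semiring
import Mathlib.Analysis.SpecialFunctions.Pow.Real
import Mathlib.Data.Finset.Sum
import Mathlib.LinearAlgebra.AffineSpace.AffineSubspace.Basic
import Mathlib.LinearAlgebra.Dimension.Constructions
import Mathlib.LinearAlgebra.Dimension.FreeAndStrongRankCondition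
import Mathlib.LinearAlgebra.FiniteDimensional.Lemmas
import HarnessLib

/-!
# Stevens–de Zeeuw, Theorem 4 — the reduction to Rudnev's point–plane bound (§2 of the paper)

Topic `Literature/Combinatorics/Additive`; proof file behind the named fact
`Literature.Combinatorics.Additive.stevensDeZeeuw_thm4` (`StevensDeZeeuwIncidence.lean`):
S. Stevens, F. de Zeeuw, *An improved point-line incidence bound over arbitrary fields*,
Bull. Lond. Math. Soc. 49 (2017) 842–858, Theorem 4 (arXiv:1609.06284).

The published proof of Theorem 4 (§2 of the paper, one page) is a reduction to the point–plane
incidence theorem of Rudnev (M. Rudnev, Combinatorica 38 (2018), Theorem 3; point form as printed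
in Stevens–de Zeeuw, Theorem 6, and in F. de Zeeuw, arXiv:1612.02719, Theorem 1.1), whose own
proof rests on the Guth–Katz / Kollár theory of ruled surfaces over arbitrary fields and is far
outside the present libraries. This file formalizes the reduction COMPLETELY and takes its one
deep input as an explicit hypothesis: the main result is

* `stevensDeZeeuw_thm4_of_pointPlane` — Rudnev's theorem (point form, Stevens–de Zeeuw Thm 6:
  "`r` points and `s ≥ r` planes in `𝔽³`, `r ≪ p²` in characteristic `p > 0`, at most `k`
  points of the point set on a line ⟹ `I ≪ r^{1/2} s + k s`", planes and lines being the affine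
  subspaces of `Fin 3 → 𝔽` whose directions have rank `2` and `1`) **implies**
  `stevensDeZeeuw_thm4`, with the constant `C = 2 + √(2 C_R)`, `C_R = C_R(c₀)` Rudnev's constant.

No new named fact is introduced (D-0026); once Rudnev's theorem is available in the tree in the
displayed form, `stevensDeZeeuw_thm4_holds` is the one-line application of this theorem.

We follow §2 of the paper step by step (namespace `StevensDeZeeuw`). Non-vertical lines
`y = m x + c` are handled through their codes `(m, c) ∈ 𝔽²` (the "affine dual" `𝓛*` of the
paper), and `inc P M` counts incidences of `P ⊆ 𝔽²` with the coded lines `M ⊆ 𝔽²`. A pencil of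
concurrent lines through `(x₀, y₀)` is the set of codes on the dual line `c = -x₀ m + y₀`, a
pencil of parallel lines the set of codes on a vertical dual line `m = m₀`; so "at most `K` lines
of `M` concurrent or parallel" reads "every dual line (coded, as all lines here, by
`(𝔽 × 𝔽) ⊕ 𝔽` and tested by `LineIncident`) contains at most `K` codes of `M`".

* `card_incidences_eq`, `card_vertical_le` — Step 1: vertical lines contribute `≤ |A||B|`.
* `inc_prod_le` — Step 2: `I(A × B, M) ≤ |A| |M|` for non-vertical lines.
* `inc_pencil_le`, `prune` — Step 3: a pencil `S` meets `P` in `≤ |P| + |S|` incidences; removing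
  pencils of more than `K` lines costs `≤ (|M| - |M'|)(1 + |P|/K)` incidences.
* `inc_sq_le` — Lemma 7 (Cauchy–Schwarz): `I(A × B, M)² ≤ |B| · |E|`,
  `E = {(x,m,c,x',m',c') : m x + c = m' x' + c'}`.
* `pt`, `plane`, `card_E_le_incidences`, `card_filter_mem_line_le` — the point–plane
  configuration: `|E| ≤ I(R, S)` for the points `R = {(x, m', c')}` and the planes
  `S = {m X + c = x' Y + Z}` of `𝔽³`, `|R| = |S| = |A||M|`, the planes distinct with direction of
  rank `2`, and a line of `𝔽³` contains at most `max(|A|, K)` points of `R`.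
* `stevensDeZeeuw_thm4_of_pointPlane` — the assembly, with the real-number bookkeeping of §2
  (`ab ≤ T`; `an ≤ T` if `b² > an`; `√(an)·b ≤ T` if `b² ≤ an`; where
  `T = a^{3/4} b^{1/2} n^{3/4}`, all read off from `T⁴ = a³ b² n³`).

## References
* [StevensDeZeeuw2017] S. Stevens, F. de Zeeuw, Bull. Lond. Math. Soc. 49 (2017) 842–858,
  doi:10.1112/blms.12077, arXiv:1609.06284 — §2 (Lemma 7 and the proof of Theorem 4), §1.5 Thm 6.
* [Rudnev2017] M. Rudnev, *On the number of incidences between points and planes in three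
  dimensions*, Combinatorica 38 (2018) 219–254, doi:10.1007/s00493-016-3329-6 — Theorem 3.
* [deZeeuw2016] F. de Zeeuw, *A short proof of Rudnev's point-plane incidence bound*,
  arXiv:1612.02719 — Theorem 1.1.
-/

namespace Literature.Combinatorics.Additive

open Finset

namespace StevensDeZeeuw

/-! ### Points and planes of `𝔽³` -/

section Geometry

variable {F : Type*}

/-- The point `(x, m, c) ∈ 𝔽³` attached to `(x, (m, c)) ∈ A × 𝓛*`.
[cite: StevensDeZeeuw2017, §2, proof of Theorem 4 (the set 𝓡)] -/
def pt (w : F × (F × F)) : Fin 3 → F := ![w.1, w.2.1, w.2.2]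

/-- Coordinates of `pt`. [folklore] -/
@[simp] theorem pt_zero (w : F × (F × F)) : pt w 0 = w.1 := rfl

/-- Coordinates of `pt`. [folklore] -/
@[simp] theorem pt_one (w : F × (F × F)) : pt w 1 = w.2.1 := rfl

/-- Coordinates of `pt`. [folklore] -/
@[simp] theorem pt_two (w : F × (F × F)) : pt w 2 = w.2.2 := rfl

/-- `pt` is injective. [folklore] -/
theorem pt_injective : Function.Injective (pt : F × (F × F) → Fin 3 → F) := fun w w' h =>
  Prod.ext (by simpa using congr_fun h 0)
    (Prod.ext (by simpa using congr_fun h 1) (by simpa using congr_fun h 2))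

variable [Field F]

/-- The evaluation `φ(x, (m, c)) = m x + c` of the paper (`φ(x, s, t) = x s + t`).
[cite: StevensDeZeeuw2017, §2, proof of Theorem 4] -/
def phi (w : F × (F × F)) : F := w.2.1 * w.1 + w.2.2

/-- The linear form `v ↦ m v₀ - x' v₁ - v₂` cutting out the direction of the plane
`m X + c = x' Y + Z`. [cite: StevensDeZeeuw2017, §2, proof of Theorem 4 (the set 𝓢)] -/
def lin (x' m : F) : (Fin 3 → F) →ₗ[F] F :=
  m • LinearMap.proj 0 - x' • LinearMap.proj 1 - LinearMap.proj 2

/-- Evaluation of `lin`. [folklore] -/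
@[simp] theorem lin_apply (x' m : F) (v : Fin 3 → F) :
    lin x' m v = m * v 0 - x' * v 1 - v 2 := by
  simp [lin]

/-- The plane `{(X, Y, Z) : m X + c = x' Y + Z}` of `𝔽³` attached to `(x', (m, c)) ∈ A × 𝓛*`.
[cite: StevensDeZeeuw2017, §2, proof of Theorem 4 (the set 𝓢)] -/
def plane (x' m c : F) : AffineSubspace F (Fin 3 → F) :=
  AffineSubspace.mk' ![0, 0, c] (LinearMap.ker (lin x' m))

/-- Membership in `plane x' m c`. [cite: StevensDeZeeuw2017, §2, proof of Theorem 4] -/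
theorem mem_plane {x' m c : F} {v : Fin 3 → F} :
    v ∈ plane x' m c ↔ m * v 0 + c = x' * v 1 + v 2 := by
  simp only [plane, AffineSubspace.mem_mk', LinearMap.mem_ker, lin_apply, vsub_eq_sub,
    Pi.sub_apply, Matrix.cons_val_zero, Matrix.cons_val_one, Matrix.head_cons,
    Matrix.cons_val_two, Matrix.tail_cons, sub_zero]
  constructor <;> intro h <;> linear_combination h

/-- The planes have direction of rank `2` (they are planes). [folklore] -/
theorem finrank_direction_plane (x' m c : F) :
    Module.finrank F (plane x' m c).direction = 2 := by
  rw [plane, AffineSubspace.direction_mk']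
  have hsurj : Function.Surjective (lin x' m) := fun y => ⟨![0, 0, -y], by simp⟩
  have h := LinearMap.finrank_range_add_finrank_ker (lin x' m)
  rw [LinearMap.range_eq_top.2 hsurj, finrank_top, Module.finrank_self,
    Module.finrank_fin_fun F] at h
  omega

/-- Distinct parameters give distinct planes. [folklore] -/
theorem plane_injective {x₁ m₁ c₁ x₂ m₂ c₂ : F} (h : plane x₁ m₁ c₁ = plane x₂ m₂ c₂) :
    x₁ = x₂ ∧ m₁ = m₂ ∧ c₁ = c₂ := by
  have e1 : (![0, 0, c₁] : Fin 3 → F) ∈ plane x₂ m₂ c₂ := by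
    rw [← h, mem_plane]; simp
  have e2 : (![1, 0, m₁ + c₁] : Fin 3 → F) ∈ plane x₂ m₂ c₂ := by
    rw [← h, mem_plane]; simp
  have e3 : (![0, 1, c₁ - x₁] : Fin 3 → F) ∈ plane x₂ m₂ c₂ := by
    rw [← h, mem_plane]; simp
  rw [mem_plane] at e1 e2 e3
  simp only [Matrix.cons_val_zero, Matrix.cons_val_one, Matrix.head_cons, Matrix.cons_val_two,
    Matrix.tail_cons, mul_zero, mul_one, zero_add] at e1 e2 e3
  exact ⟨by linear_combination e3 - e1, by linear_combination e1 - e2,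
    by linear_combination (-1 : F) * e1⟩

end Geometry

/-! ### Incidences with coded non-vertical lines -/

section Combinatorics

variable {F : Type*} [Field F] [DecidableEq F]

/-- `inc P M`: the number of incidences between the points `P ⊆ 𝔽²` and the non-vertical lines
with codes in `M ⊆ 𝔽²` (code `(m, c)` = line `y = m x + c`, the affine dual of the paper).
[cite: StevensDeZeeuw2017, §2] -/
def inc (P M : Finset (F × F)) : ℕ :=
  ((P ×ˢ M).filter fun z => z.1.2 = z.2.1 * z.1.1 + z.2.2).card

/-- Incidences are additive over a partition of the line set. [folklore] -/
theorem inc_eq_add_sdiff (P : Finset (F × F)) {S M : Finset (F × F)} (h : S ⊆ M) :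
    inc P M = inc P S + inc P (M \ S) := by
  unfold inc
  rw [← card_union_of_disjoint]
  · rw [← filter_union, ← product_union, union_sdiff_of_subset h]
  · exact disjoint_filter_filter (disjoint_product.2 (Or.inr disjoint_sdiff))

/-- A pencil meets any point set `P` in at most `|P| + |S|` incidences: if all codes of `S` lie
on one dual line `d` (the lines of `S` are concurrent, `d = inl _`, or parallel, `d = inr _`),
then `inc P S ≤ |P| + |S|`. [cite: StevensDeZeeuw2017, §2, proof of Theorem 4 (third bullet)] -/
theorem inc_pencil_le (P S : Finset (F × F)) (d : (F × F) ⊕ F)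
    (hS : ∀ ℓ ∈ S, LineIncident ℓ d) : inc P S ≤ P.card + S.card := by
  unfold inc
  rcases d with ⟨α, β⟩ | α
  · -- concurrent lines through `q₀ = (-α, β)`: the codes satisfy `c = α m + β`
    have hsplit := card_filter_add_card_filter_not
      (s := (P ×ˢ S).filter fun z => z.1.2 = z.2.1 * z.1.1 + z.2.2)
      (fun z : (F × F) × (F × F) => z.1 = (-α, β))
    -- incidences at `q₀` itself: at most one per line
    have h1 : (((P ×ˢ S).filter fun z => z.1.2 = z.2.1 * z.1.1 + z.2.2).filter
        fun z : (F × F) × (F × F) => z.1 = (-α, β)).card ≤ S.card := by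
      refine card_le_card_of_injOn (fun z => z.2) ?_ ?_
      · intro z hz
        simp only [coe_filter, Set.mem_setOf_eq, mem_filter, mem_product] at hz
        exact mem_coe.2 hz.1.1.2
      · intro z hz z' hz' hzz
        simp only [coe_filter, Set.mem_setOf_eq, mem_filter, mem_product] at hz hz'
        exact Prod.ext (hz.2.trans hz'.2.symm) hzz
    -- points other than `q₀` lie on at most one line of the pencil
    have h2 : (((P ×ˢ S).filter fun z => z.1.2 = z.2.1 * z.1.1 + z.2.2).filter
        fun z : (F × F) × (F × F) => ¬ z.1 = (-α, β)).card ≤ P.card := by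
      refine card_le_card_of_injOn (fun z => z.1) ?_ ?_
      · intro z hz
        simp only [coe_filter, Set.mem_setOf_eq, mem_filter, mem_product] at hz
        exact mem_coe.2 hz.1.1.1
      · intro z hz z' hz' hzz
        simp only [coe_filter, Set.mem_setOf_eq, mem_filter, mem_product] at hz hz'
        obtain ⟨⟨⟨-, hzS⟩, hzi⟩, hzq⟩ := hz
        obtain ⟨⟨⟨-, hz'S⟩, hz'i⟩, -⟩ := hz'
        have hc := hS _ hzS
        have hc' := hS _ hz'S
        simp only [LineIncident] at hc hc'
        simp only at hzz
        rw [← hzz] at hz'i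
        have key : (z.2.1 - z'.2.1) * (z.1.1 + α) = 0 := by
          linear_combination (-1 : F) * hzi + hz'i - hc + hc'
        rcases mul_eq_zero.1 key with h0 | h0
        · have hm : z.2.1 = z'.2.1 := sub_eq_zero.1 h0
          exact Prod.ext hzz (Prod.ext hm (by linear_combination hc - hc' + α * hm))
        · refine absurd (Prod.ext ?_ ?_) hzq
          · show z.1.1 = -α
            linear_combination h0
          · show z.1.2 = β
            linear_combination hzi + z.2.1 * h0 + hc
    omega
  · -- parallel lines of slope `α`: every point lies on at most one of them
    refine (card_le_card_of_injOn (fun z => z.1) ?_ ?_).trans (Nat.le_add_right _ _)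
    · intro z hz
      simp only [coe_filter, Set.mem_setOf_eq, mem_product] at hz
      exact mem_coe.2 hz.1.1
    · intro z hz z' hz' hzz
      simp only [coe_filter, Set.mem_setOf_eq, mem_product] at hz hz'
      have hc := hS _ hz.1.2
      have hc' := hS _ hz'.1.2
      simp only [LineIncident] at hc hc'
      simp only at hzz
      have hi := hz.2
      have hi' := hz'.2
      rw [← hzz] at hi'
      exact Prod.ext hzz (Prod.ext (hc.trans hc'.symm)
        (by linear_combination (-1 : F) * hi + hi' - z.1.1 * hc + z.1.1 * hc'))

/-- On a Cartesian product, non-vertical lines give at most `|A| |M|` incidences (each line meets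
each vertical line `x = x₀`, `x₀ ∈ A`, at most once).
[cite: StevensDeZeeuw2017, §2, proof of Theorem 4 (second bullet)] -/
theorem inc_prod_le (A B : Finset F) (M : Finset (F × F)) :
    inc (A ×ˢ B) M ≤ A.card * M.card := by
  unfold inc
  rw [← card_product]
  refine card_le_card_of_injOn (fun z => (z.1.1, z.2)) ?_ ?_
  · intro z hz
    simp only [coe_filter, Set.mem_setOf_eq, mem_product] at hz
    exact mem_coe.2 (mem_product.2 ⟨hz.1.1.1, hz.1.2⟩)
  · intro z hz z' hz' h
    simp only [coe_filter, Set.mem_setOf_eq, mem_product] at hz hz'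
    simp only [Prod.mk.injEq] at h
    obtain ⟨hx, hl⟩ := h
    refine Prod.ext (Prod.ext hx ?_) hl
    rw [hz.2, hz'.2, hx, hl]

/-- **Pruning the pencils** (Step 3 of the proof of Theorem 4): for `K > 0` one can remove lines
from `M` so that afterwards no dual line contains more than `K` codes (no pencil of more than `K`
concurrent or parallel lines remains), losing at most `(|M| - |M'|)(1 + |P|/K)` incidences — each
removed pencil of `nᵢ > K` lines accounts for `≤ |P| + nᵢ` incidences and there are
`≤ (|M| - |M'|)/K` removals. [cite: StevensDeZeeuw2017, §2, proof of Theorem 4 (third bullet)] -/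
theorem prune (P : Finset (F × F)) {K : ℝ} (hK : 0 < K) (M : Finset (F × F)) :
    ∃ M' ⊆ M, (∀ d : (F × F) ⊕ F, ((M'.filter fun ℓ => LineIncident ℓ d).card : ℝ) ≤ K) ∧
      (inc P M : ℝ) ≤ inc P M' + (M.card - M'.card) * (1 + P.card / K) := by
  induction M using Finset.strongInduction with
  | H M ih =>
    by_cases h : ∀ d : (F × F) ⊕ F, ((M.filter fun ℓ => LineIncident ℓ d).card : ℝ) ≤ K
    · exact ⟨M, Subset.rfl, h, by simp⟩
    simp only [not_forall, not_le] at h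
    obtain ⟨d, hd⟩ := h
    set S := M.filter fun ℓ => LineIncident ℓ d with hS
    have hSM : S ⊆ M := filter_subset _ _
    have hSpos : 0 < S.card := by exact_mod_cast hK.trans hd
    obtain ⟨M', hM'sub, hM'K, hM'inc⟩ := ih (M \ S) (sdiff_ssubset hSM (card_pos.1 hSpos))
    refine ⟨M', hM'sub.trans sdiff_subset, hM'K, ?_⟩
    have h1 : inc P M = inc P S + inc P (M \ S) := inc_eq_add_sdiff P hSM
    have h2 : ((inc P S : ℕ) : ℝ) ≤ P.card + S.card := by
      exact_mod_cast inc_pencil_le P S d fun ℓ hℓ => (mem_filter.1 hℓ).2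
    have h3 : ((M \ S).card : ℝ) = M.card - S.card := by
      rw [card_sdiff_of_subset hSM, Nat.cast_sub (card_le_card hSM)]
    have h4 : (P.card : ℝ) ≤ S.card * (P.card / K) := by
      rw [mul_div_assoc', le_div_iff₀ hK]
      nlinarith [hd.le, (Nat.cast_nonneg P.card : (0 : ℝ) ≤ P.card)]
    rw [h3] at hM'inc
    rw [h1]
    push_cast
    linarith [hM'inc, h2, h4]

/-! ### Lemma 7: Cauchy–Schwarz -/

/-- `I(A × B, 𝓛) = |{(x, y, s, t) ∈ A × B × 𝓛* : x s + t = y}|`, reindexed as the pairs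
`((x, (s, t)), y)` with `φ(x, s, t) = y`. [cite: StevensDeZeeuw2017, §2, proof of Theorem 4] -/
theorem inc_prod_eq_card (A B : Finset F) (M : Finset (F × F)) :
    inc (A ×ˢ B) M = (((A ×ˢ M) ×ˢ B).filter fun v => phi v.1 = v.2).card := by
  unfold inc
  refine card_nbij' (fun z => ((z.1.1, z.2), z.1.2)) (fun v => ((v.1.1, v.2), v.1.2))
    ?_ ?_ (fun z _ => rfl) (fun v _ => rfl)
  · intro z hz
    simp only [coe_filter, Set.mem_setOf_eq, mem_product, phi] at hz ⊢
    exact ⟨⟨⟨hz.1.1.1, hz.1.2⟩, hz.1.1.2⟩, hz.2.symm⟩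
  · intro v hv
    simp only [coe_filter, Set.mem_setOf_eq, mem_product, phi] at hv ⊢
    exact ⟨⟨⟨hv.1.1.1, hv.1.2⟩, hv.1.1.2⟩, hv.2.symm⟩

/-- **Lemma 7** (Cauchy–Schwarz) in the form used for Theorem 4:
`I(A × B, 𝓛)² ≤ |B| · |E|` with `E = {((x,s,t),(x',s',t')) ∈ (A × 𝓛*)² : x s + t = x' s' + t'}`.
[cite: StevensDeZeeuw2017, Lemma 7 and eq. (4)] -/
theorem inc_sq_le (A B : Finset F) (M : Finset (F × F)) :
    inc (A ×ˢ B) M ^ 2 ≤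
      B.card * (((A ×ˢ M) ×ˢ (A ×ˢ M)).filter fun e => phi e.1 = phi e.2).card := by
  set X := A ×ˢ M with hX
  set E := (X ×ˢ X).filter fun e => phi e.1 = phi e.2 with hE
  have h1 : inc (A ×ˢ B) M = ∑ y ∈ B, (X.filter fun w => phi w = y).card := by
    rw [inc_prod_eq_card, card_filter, sum_product_right]
    refine sum_congr rfl fun y _ => ?_
    rw [card_filter]
  have h2 : ∀ y, (X.filter fun w => phi w = y).card ^ 2 =
      (E.filter fun e => phi e.1 = y).card := by
    intro y
    rw [sq, ← card_product]
    congr 1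
    ext e
    simp only [mem_product, mem_filter, hE]
    constructor
    · rintro ⟨⟨he1, he2⟩, he3, he4⟩
      exact ⟨⟨⟨he1, he3⟩, he2.trans he4.symm⟩, he2⟩
    · rintro ⟨⟨⟨he1, he3⟩, he5⟩, he2⟩
      exact ⟨⟨he1, he2⟩, he3, he5.symm.trans he2⟩
  rw [h1]
  calc (∑ y ∈ B, (X.filter fun w => phi w = y).card) ^ 2
      ≤ B.card * ∑ y ∈ B, (X.filter fun w => phi w = y).card ^ 2 := sq_sum_le_card_mul_sum_sq
    _ = B.card * ∑ y ∈ B, (E.filter fun e => phi e.1 = y).card := by simp_rw [h2]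
    _ = B.card * (E.filter fun e => phi e.1 ∈ B).card := by
        rw [sum_card_fiberwise_eq_card_filter]
    _ ≤ B.card * E.card := Nat.mul_le_mul_left _ (card_filter_le _ _)

/-! ### Step 1: vertical lines -/

/-- Splitting the incidences of `P` with a set of coded lines into the vertical lines
(`inr c` : `x = c`) and the non-vertical ones (`inl (m, c)`, counted by `inc`). [folklore] -/
theorem card_incidences_eq (P : Finset (F × F)) (L : Finset ((F × F) ⊕ F)) :
    ((P ×ˢ L).filter fun q => LineIncident q.1 q.2).card =
      ((P ×ˢ L.toRight).filter fun z => z.1.1 = z.2).card + inc P L.toLeft := by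
  have key : ((P ×ˢ L).filter fun q => LineIncident q.1 q.2).card =
      ∑ ℓ ∈ L, (P.filter fun q => LineIncident q ℓ).card := by
    rw [card_filter, sum_product_right]
    refine sum_congr rfl fun ℓ _ => ?_
    rw [card_filter]
  rw [key, sum_sum_eq_sum_toLeft_add_sum_toRight, add_comm]
  congr 1
  · rw [card_filter, sum_product_right]
    refine sum_congr rfl fun c _ => ?_
    rw [card_filter]
    rfl
  · unfold inc
    rw [card_filter, sum_product_right]
    refine sum_congr rfl fun l _ => ?_
    rw [card_filter]
    rfl

omit [Field F] in
/-- Every point lies on at most one vertical line: the vertical lines contribute at most `|P|`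
incidences. [cite: StevensDeZeeuw2017, §2, proof of Theorem 4 (first bullet)] -/
theorem card_vertical_le (P : Finset (F × F)) (V : Finset F) :
    ((P ×ˢ V).filter fun z => z.1.1 = z.2).card ≤ P.card := by
  refine card_le_card_of_injOn (fun z => z.1) ?_ ?_
  · intro z hz
    simp only [coe_filter, Set.mem_setOf_eq, mem_product] at hz
    exact mem_coe.2 hz.1.1
  · intro z hz z' hz' h
    simp only [coe_filter, Set.mem_setOf_eq, mem_product] at hz hz'
    have h1 : z.1 = z'.1 := h
    have h2 : z.2 = z'.2 := by rw [← hz.2, ← hz'.2, h1]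
    exact Prod.ext h1 h2

/-! ### The point–plane configuration: `|E| ≤ I(𝓡, 𝓢)` and collinear points of `𝓡` -/

open scoped Classical in
/-- `|E| ≤ I(𝓡, 𝓢)`: the solution `((x,s,t),(x',s',t'))` of `x s + t = x' s' + t'` is the
incidence of the point `(x, s', t') ∈ 𝓡 = A × 𝓛*` with the plane `X s + t = x' Y + Z` of `𝓢`,
injectively. [cite: StevensDeZeeuw2017, §2, proof of Theorem 4] -/
theorem card_E_le_incidences (A : Finset F) (M : Finset (F × F)) :
    (((A ×ˢ M) ×ˢ (A ×ˢ M)).filter fun e => phi e.1 = phi e.2).card ≤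
      ((((A ×ˢ M).image pt) ×ˢ ((A ×ˢ M).image fun w => plane w.1 w.2.1 w.2.2)).filter
        fun i => i.1 ∈ i.2).card := by
  refine card_le_card_of_injOn
    (fun e => (pt (e.1.1, e.2.2), plane e.2.1 e.1.2.1 e.1.2.2)) ?_ ?_
  · intro e he
    simp only [coe_filter, Set.mem_setOf_eq, mem_product] at he
    obtain ⟨⟨⟨hx, hl⟩, hx', hl'⟩, hphi⟩ := he
    simp only [coe_filter, Set.mem_setOf_eq, mem_product, mem_image]
    refine ⟨⟨⟨(e.1.1, e.2.2), ⟨hx, hl'⟩, rfl⟩, ⟨(e.2.1, e.1.2), ⟨hx', hl⟩, rfl⟩⟩, ?_⟩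
    rw [mem_plane]
    simp only [pt_zero, pt_one, pt_two, phi] at hphi ⊢
    linear_combination hphi
  · intro e _ e' _ h
    simp only [Prod.mk.injEq] at h
    obtain ⟨h1, h2⟩ := h
    have h1' := pt_injective h1
    simp only [Prod.mk.injEq] at h1'
    obtain ⟨h3, h4, h5⟩ := plane_injective h2
    exact Prod.ext (Prod.ext h1'.1 (Prod.ext h4 h5)) (Prod.ext h3 h1'.2)

open scoped Classical in
/-- **Collinear points of `𝓡 = A × 𝓛*`**: a line of `𝔽³` contains at most `max(|A|, K)` points
of `𝓡`, where `K` bounds the number of codes of `𝓛*` on a dual line (the number of concurrent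
or parallel lines of `𝓛`). [cite: StevensDeZeeuw2017, §2, proof of Theorem 4] -/
theorem card_filter_mem_line_le (A : Finset F) (M : Finset (F × F)) (k : ℕ) (hA : A.card ≤ k)
    (hM : ∀ d : (F × F) ⊕ F, (M.filter fun ℓ => LineIncident ℓ d).card ≤ k)
    (ℓ : AffineSubspace F (Fin 3 → F)) (hℓ : Module.finrank F ℓ.direction = 1) :
    (((A ×ˢ M).image pt).filter fun v => v ∈ ℓ).card ≤ k := by
  rcases ℓ.eq_bot_or_nonempty with hbot | ⟨p₀, hp₀⟩
  · exfalso
    rw [hbot, AffineSubspace.direction_bot, finrank_bot] at hℓ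
    exact zero_ne_one hℓ
  obtain ⟨⟨v, hv⟩, -, hspan⟩ := finrank_eq_one_iff'.1 hℓ
  have hpar : ∀ q ∈ ℓ, ∃ t : F, q = p₀ + t • v := by
    intro q hq
    obtain ⟨t, ht⟩ := hspan ⟨q -ᵥ p₀, AffineSubspace.vsub_mem_direction hq hp₀⟩
    refine ⟨t, ?_⟩
    have ht' : t • v = q - p₀ := by simpa using congr_arg Subtype.val ht
    rw [ht']
    abel
  by_cases hd : v 1 = 0 ∧ v 2 = 0
  · calc (((A ×ˢ M).image pt).filter fun v => v ∈ ℓ).card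
        ≤ (A.image fun x => (![x, p₀ 1, p₀ 2] : Fin 3 → F)).card := card_le_card ?_
      _ ≤ A.card := card_image_le
      _ ≤ k := hA
    intro u hu
    simp only [mem_filter, mem_image, mem_product] at hu ⊢
    obtain ⟨⟨w, ⟨hwA, -⟩, rfl⟩, hu⟩ := hu
    obtain ⟨t, ht⟩ := hpar _ hu
    refine ⟨w.1, hwA, ?_⟩
    have h1 := congr_fun ht 1
    have h2 := congr_fun ht 2
    simp only [pt_one, pt_two, Pi.add_apply, Pi.smul_apply, smul_eq_mul, hd.1, hd.2, mul_zero,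
      add_zero] at h1 h2
    ext i
    fin_cases i <;> simp [pt, h1, h2]
  · calc (((A ×ˢ M).image pt).filter fun v => v ∈ ℓ).card
        ≤ (M.filter fun ℓ' => LineIncident ℓ'
            (if v 1 = 0 then Sum.inr (p₀ 1)
              else Sum.inl (v 2 / v 1, p₀ 2 - v 2 / v 1 * p₀ 1))).card := ?_
      _ ≤ k := hM _
    refine card_le_card_of_injOn (fun u => (u 1, u 2)) ?_ ?_
    · intro u hu
      simp only [coe_filter, Set.mem_setOf_eq, mem_image, mem_product] at hu ⊢
      obtain ⟨⟨w, ⟨-, hwM⟩, rfl⟩, hu⟩ := hu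
      refine ⟨by simpa using hwM, ?_⟩
      obtain ⟨t, ht⟩ := hpar _ hu
      have h1 := congr_fun ht 1
      have h2 := congr_fun ht 2
      simp only [pt_one, pt_two, Pi.add_apply, Pi.smul_apply, smul_eq_mul] at h1 h2
      simp only [pt_one, pt_two]
      split_ifs with hv1
      · simp only [LineIncident]
        rw [h1, hv1, mul_zero, add_zero]
      · simp only [LineIncident]
        rw [h1, h2]
        field_simp
        ring
    · intro u hu u' hu' huu
      simp only [coe_filter, Set.mem_setOf_eq] at hu hu'
      obtain ⟨t, ht⟩ := hpar _ hu.2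
      obtain ⟨t', ht'⟩ := hpar _ hu'.2
      simp only [Prod.mk.injEq] at huu
      have h1 := congr_fun ht 1
      have h2 := congr_fun ht 2
      have h1' := congr_fun ht' 1
      have h2' := congr_fun ht' 2
      simp only [Pi.add_apply, Pi.smul_apply, smul_eq_mul] at h1 h2 h1' h2'
      have htt : t = t' := by
        by_cases hv1 : v 1 = 0
        · have hv2 : v 2 ≠ 0 := fun h => hd ⟨hv1, h⟩
          refine mul_right_cancel₀ hv2 ?_
          linear_combination (-1 : F) * h2 + h2' + huu.2
        · refine mul_right_cancel₀ hv1 ?_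
          linear_combination (-1 : F) * h1 + h1' + huu.1
      rw [ht, ht', htt]

end Combinatorics

end StevensDeZeeuw

open StevensDeZeeuw in
open scoped Classical in
/-- **Stevens–de Zeeuw, Theorem 4, from Rudnev's point–plane incidence theorem.** The hypothesis
is Rudnev's theorem in the point form printed as Stevens–de Zeeuw's Theorem 6 (= de Zeeuw 2016,
Thm 1.1; projectively dual to Rudnev, Combinatorica 2018, Thm 3): for every `c₀ > 0` there is
`C > 0` such that for every field `𝔽`, all finite sets `P` of points and `Q` of planes of `𝔽³`
(affine subspaces of `Fin 3 → 𝔽` with direction of rank `2`) with `|P| ≤ |Q|`, `|P| ≤ c₀ p²` in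
positive characteristic `p`, and at most `k` points of `P` on any line (direction of rank `1`),
`I(P, Q) ≤ C (|P|^{1/2} |Q| + k |Q|)`. The conclusion is the named fact `stevensDeZeeuw_thm4`
(Theorem 4 as printed), obtained by the argument of §2 of the paper with `C = 2 + √(2 C_R(c₀))`.
[cite: StevensDeZeeuw2017, Theorem 4 and §2 (proof), Theorem 6 (hypothesis)] -/
theorem stevensDeZeeuw_thm4_of_pointPlane
    (hR : ∀ c₀ : ℝ, 0 < c₀ → ∃ C : ℝ, 0 < C ∧
      ∀ (F : Type) [Field F] (P : Finset (Fin 3 → F)) (Q : Finset (AffineSubspace F (Fin 3 → F)))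
        (k : ℕ),
        (∀ π ∈ Q, Module.finrank F π.direction = 2) →
        P.card ≤ Q.card →
        (ringChar F = 0 ∨ (P.card : ℝ) ≤ c₀ * (ringChar F : ℝ) ^ 2) →
        (∀ ℓ : AffineSubspace F (Fin 3 → F), Module.finrank F ℓ.direction = 1 →
          (P.filter fun q => q ∈ ℓ).card ≤ k) →
        (((P ×ˢ Q).filter fun i => i.1 ∈ i.2).card : ℝ) ≤
          C * ((P.card : ℝ) ^ (1 / 2 : ℝ) * (Q.card : ℝ) + (k : ℝ) * (Q.card : ℝ))) :
    stevensDeZeeuw_thm4 := by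
  intro c₀ hc₀
  obtain ⟨CR, hCR, hRud⟩ := hR c₀ hc₀
  refine ⟨2 + Real.sqrt (2 * CR), by positivity, ?_⟩
  intro F _ _ A B L hab habn hchar
  -- real abbreviations `a, b, n` and the main term `T = a^{3/4} b^{1/2} n^{3/4}`
  set a : ℝ := (A.card : ℝ) with ha
  set b : ℝ := (B.card : ℝ) with hb
  set n : ℝ := (L.card : ℝ) with hn
  clear_value a b n
  have ha0 : 0 ≤ a := by rw [ha]; exact Nat.cast_nonneg _
  have hb0 : 0 ≤ b := by rw [hb]; exact Nat.cast_nonneg _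
  have hn0 : 0 ≤ n := by rw [hn]; exact Nat.cast_nonneg _
  set T : ℝ := a ^ (3 / 4 : ℝ) * b ^ (1 / 2 : ℝ) * n ^ (3 / 4 : ℝ) with hT
  clear_value T
  have hT0 : 0 ≤ T := by rw [hT]; positivity
  have hT4 : T ^ 4 = a ^ 3 * b ^ 2 * n ^ 3 := by
    -- `(x^{3/4})⁴ = x³` and `(x^{1/2})⁴ = x²` for `x ≥ 0`
    have e1 : ∀ x : ℝ, 0 ≤ x → (x ^ (3 / 4 : ℝ)) ^ 4 = x ^ 3 := fun x hx => by
      rw [← Real.rpow_natCast, ← Real.rpow_mul hx]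
      norm_num
    have e2 : ∀ x : ℝ, 0 ≤ x → (x ^ (1 / 2 : ℝ)) ^ 4 = x ^ 2 := fun x hx => by
      rw [← Real.rpow_natCast, ← Real.rpow_mul hx]
      norm_num
    rw [hT, mul_pow, mul_pow, e1 a ha0, e2 b hb0, e1 n hn0]
  have hsq0 : 0 ≤ Real.sqrt (2 * CR) := Real.sqrt_nonneg _
  -- Step 0: the degenerate cases `A = ∅` or `𝓛 = ∅`
  by_cases h0 : A.card = 0 ∨ L.card = 0
  · have hcard0 : (((A ×ˢ B) ×ˢ L).filter fun q => LineIncident q.1 q.2).card = 0 := by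
      apply Nat.eq_zero_of_le_zero
      calc (((A ×ˢ B) ×ˢ L).filter fun q => LineIncident q.1 q.2).card
          ≤ ((A ×ˢ B) ×ˢ L).card := card_filter_le _ _
        _ = 0 := by rw [card_product, card_product]; rcases h0 with h | h <;> simp [h]
    rw [hcard0]
    push_cast
    positivity
  obtain ⟨hA0, hL0⟩ := not_or.1 h0
  have ha1 : 1 ≤ a := by rw [ha]; exact_mod_cast Nat.pos_of_ne_zero hA0
  have hn1 : 1 ≤ n := by rw [hn]; exact_mod_cast Nat.pos_of_ne_zero hL0
  have hab' : a ≤ b := by rw [ha, hb]; exact_mod_cast hab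
  -- `ab ≤ T` (from `ab² ≤ n³`) and `a ≤ n` (from `a ≤ b`, `ab² ≤ n³`)
  have hab_T : a * b ≤ T := by
    refine le_of_pow_le_pow_left₀ (by norm_num : (4 : ℕ) ≠ 0) hT0 ?_
    rw [hT4]
    calc (a * b) ^ 4 = a ^ 3 * b ^ 2 * (a * b ^ 2) := by ring
      _ ≤ a ^ 3 * b ^ 2 * n ^ 3 := by gcongr
  have ha_n : a ≤ n := by
    refine le_of_pow_le_pow_left₀ (by norm_num : (3 : ℕ) ≠ 0) hn0 ?_
    calc a ^ 3 = a * a ^ 2 := by ring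
      _ ≤ a * b ^ 2 := by gcongr
      _ ≤ n ^ 3 := habn
  -- Step 1: split off the vertical lines
  have hPcard : ((A ×ˢ B).card : ℝ) = a * b := by rw [card_product, Nat.cast_mul, ha, hb]
  have hMn : (L.toLeft.card : ℝ) ≤ n := by rw [hn]; exact_mod_cast card_toLeft_le
  have hI : ((((A ×ˢ B) ×ˢ L).filter fun q => LineIncident q.1 q.2).card : ℝ) ≤
      a * b + inc (A ×ˢ B) L.toLeft := by
    have hv : ((((A ×ˢ B) ×ˢ L.toRight).filter fun z => z.1.1 = z.2).card : ℝ) ≤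
        (A ×ˢ B).card := by
      exact_mod_cast card_vertical_le (A ×ˢ B) L.toRight
    rw [card_incidences_eq (A ×ˢ B) L, ← hPcard]
    push_cast
    linarith
  suffices hmain : (inc (A ×ˢ B) L.toLeft : ℝ) ≤ T + n + Real.sqrt (2 * CR) * T by
    calc ((((A ×ˢ B) ×ˢ L).filter fun q => LineIncident q.1 q.2).card : ℝ)
        ≤ a * b + inc (A ×ˢ B) L.toLeft := hI
      _ ≤ T + (T + n + Real.sqrt (2 * CR) * T) := add_le_add hab_T hmain
      _ = (2 + Real.sqrt (2 * CR)) * T + n := by ring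
      _ ≤ (2 + Real.sqrt (2 * CR)) * (T + n) := by nlinarith [mul_nonneg hsq0 hn0]
  -- Step 2: the case `b² > an`
  by_cases hcase : a * n < b ^ 2
  · have h1 : (inc (A ×ˢ B) L.toLeft : ℝ) ≤ a * L.toLeft.card := by
      rw [ha]; exact_mod_cast inc_prod_le A B L.toLeft
    have h2 : a * n ≤ T := by
      refine le_of_pow_le_pow_left₀ (by norm_num : (4 : ℕ) ≠ 0) hT0 ?_
      rw [hT4]
      calc (a * n) ^ 4 = a ^ 3 * n ^ 3 * (a * n) := by ring
        _ ≤ a ^ 3 * n ^ 3 * b ^ 2 := by gcongr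
        _ = a ^ 3 * b ^ 2 * n ^ 3 := by ring
    have h3 : a * L.toLeft.card ≤ a * n := by gcongr
    linarith [mul_nonneg hsq0 hT0]
  have hcase' : b ^ 2 ≤ a * n := not_lt.1 hcase
  have han : 0 < a * n := by positivity
  -- Step 3: prune the pencils of more than `K = (an)^{1/2}` lines
  set K : ℝ := Real.sqrt (a * n) with hK
  clear_value K
  have hKpos : 0 < K := by rw [hK]; exact Real.sqrt_pos.2 han
  have hK2 : K ^ 2 = a * n := by rw [hK]; exact Real.sq_sqrt han.le
  obtain ⟨M', hM'M, hM'K, hM'inc⟩ := prune (A ×ˢ B) hKpos L.toLeft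
  have hM'n : (M'.card : ℝ) ≤ n := le_trans (by exact_mod_cast card_le_card hM'M) hMn
  have hloss : ((L.toLeft.card : ℝ) - M'.card) * (1 + (A ×ˢ B).card / K) ≤ n + T := by
    have h1 : (L.toLeft.card : ℝ) - M'.card ≤ n := by
      linarith [(Nat.cast_nonneg M'.card : (0 : ℝ) ≤ _)]
    have h2 : (0 : ℝ) ≤ 1 + (A ×ˢ B).card / K := by positivity
    have h3 : n * ((A ×ˢ B).card / K) ≤ T := by
      rw [hPcard]
      have hKb : n * (a * b / K) = K * b := by
        rw [← mul_div_assoc, eq_comm, eq_div_iff hKpos.ne']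
        linear_combination b * hK2
      rw [hKb]
      refine le_of_pow_le_pow_left₀ (by norm_num : (4 : ℕ) ≠ 0) hT0 ?_
      rw [hT4]
      calc (K * b) ^ 4 = (K ^ 2) ^ 2 * b ^ 2 * b ^ 2 := by ring
        _ = (a * n) ^ 2 * b ^ 2 * b ^ 2 := by rw [hK2]
        _ ≤ (a * n) ^ 2 * b ^ 2 * (a * n) := by gcongr
        _ = a ^ 3 * b ^ 2 * n ^ 3 := by ring
    calc ((L.toLeft.card : ℝ) - M'.card) * (1 + (A ×ˢ B).card / K)
        ≤ n * (1 + (A ×ˢ B).card / K) := mul_le_mul_of_nonneg_right h1 h2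
      _ = n + n * ((A ×ˢ B).card / K) := by ring
      _ ≤ n + T := by linarith
  -- Step 4: Cauchy–Schwarz and Rudnev's bound for the pruned line set `M'`
  have hmain' : (inc (A ×ˢ B) M' : ℝ) ≤ Real.sqrt (2 * CR) * T := by
    have hCS := inc_sq_le A B M'
    have hEI := card_E_le_incidences A M'
    set X := A ×ˢ M' with hX
    set E := (X ×ˢ X).filter fun e => phi e.1 = phi e.2 with hE
    set R := X.image pt with hRdef
    set S := X.image (fun w => plane w.1 w.2.1 w.2.2) with hSdef
    clear_value E R S X
    have hRcard : R.card = X.card := by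
      rw [hRdef]
      exact card_image_of_injective _ pt_injective
    have hScard : S.card = X.card := by
      rw [hSdef]
      exact card_image_of_injOn fun w _ w' _ h => by
        obtain ⟨h1, h2, h3⟩ := plane_injective h
        exact Prod.ext h1 (Prod.ext h2 h3)
    have hXcard : (X.card : ℝ) = a * M'.card := by rw [hX, card_product, Nat.cast_mul, ha]
    set k : ℕ := ⌊K⌋₊ with hk
    clear_value k
    have hkK : (k : ℝ) ≤ K := by rw [hk]; exact Nat.floor_le hKpos.le
    have hplanes : ∀ π ∈ S, Module.finrank F π.direction = 2 := by
      intro π hπ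
      rw [hSdef] at hπ
      obtain ⟨w, -, rfl⟩ := mem_image.1 hπ
      exact finrank_direction_plane _ _ _
    have hRS : R.card ≤ S.card := by rw [hRcard, hScard]
    have hR_an : (R.card : ℝ) ≤ a * n := by
      rw [hRcard, hXcard]
      exact mul_le_mul_of_nonneg_left hM'n ha0
    have hcharR : ringChar F = 0 ∨ (R.card : ℝ) ≤ c₀ * (ringChar F : ℝ) ^ 2 := by
      rcases hchar with h | h
      · exact Or.inl h
      · exact Or.inr (hR_an.trans h)
    have hAk : A.card ≤ k := by
      rw [hk, Nat.le_floor_iff hKpos.le, ← ha, hK, Real.le_sqrt ha0 han.le]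
      nlinarith
    have hpencil : ∀ dl : (F × F) ⊕ F, (M'.filter fun ℓ => LineIncident ℓ dl).card ≤ k := by
      intro dl
      rw [hk, Nat.le_floor_iff hKpos.le]
      exact hM'K dl
    have hcoll : ∀ ℓ : AffineSubspace F (Fin 3 → F), Module.finrank F ℓ.direction = 1 →
        (R.filter fun q => q ∈ ℓ).card ≤ k := by
      intro ℓ hℓ
      rw [hRdef, hX]
      exact card_filter_mem_line_le A M' k hAk hpencil ℓ hℓ
    have hRud' := hRud F R S k hplanes hRS hcharR hcoll
    have hS_an : (S.card : ℝ) ≤ a * n := by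
      rw [hScard, hXcard]
      exact mul_le_mul_of_nonneg_left hM'n ha0
    have hR_sqrt : (R.card : ℝ) ^ (1 / 2 : ℝ) ≤ K := by
      rw [← Real.sqrt_eq_rpow, hK]
      exact Real.sqrt_le_sqrt hR_an
    have hIRS : (((R ×ˢ S).filter fun i => i.1 ∈ i.2).card : ℝ) ≤ CR * (2 * K * (a * n)) := by
      calc (((R ×ˢ S).filter fun i => i.1 ∈ i.2).card : ℝ)
          ≤ CR * ((R.card : ℝ) ^ (1 / 2 : ℝ) * S.card + k * S.card) := hRud'
        _ ≤ CR * (K * (a * n) + K * (a * n)) := by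
            refine mul_le_mul_of_nonneg_left (add_le_add ?_ ?_) hCR.le
            · exact mul_le_mul hR_sqrt hS_an (Nat.cast_nonneg _) hKpos.le
            · exact mul_le_mul hkK hS_an (Nat.cast_nonneg _) hKpos.le
        _ = CR * (2 * K * (a * n)) := by ring
    have hT2 : T ^ 2 = b * (a * n) * K := by
      have hbK : 0 ≤ b * (a * n) * K := by positivity
      refine (pow_left_inj₀ (by positivity) hbK two_ne_zero).1 ?_
      calc (T ^ 2) ^ 2 = T ^ 4 := by ring
        _ = a ^ 3 * b ^ 2 * n ^ 3 := hT4
        _ = (b * (a * n)) ^ 2 * (a * n) := by ring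
        _ = (b * (a * n)) ^ 2 * K ^ 2 := by rw [hK2]
        _ = (b * (a * n) * K) ^ 2 := by ring
    have hsq : ((inc (A ×ˢ B) M' : ℕ) : ℝ) ^ 2 ≤ (Real.sqrt (2 * CR) * T) ^ 2 := by
      have hE' : (E.card : ℝ) ≤ CR * (2 * K * (a * n)) :=
        le_trans (by exact_mod_cast hEI) hIRS
      have hCS' : ((inc (A ×ˢ B) M' : ℕ) : ℝ) ^ 2 ≤ b * E.card := by
        rw [hb]
        exact_mod_cast hCS
      calc ((inc (A ×ˢ B) M' : ℕ) : ℝ) ^ 2 ≤ b * E.card := hCS'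
        _ ≤ b * (CR * (2 * K * (a * n))) := mul_le_mul_of_nonneg_left hE' hb0
        _ = (2 * CR) * T ^ 2 := by rw [hT2]; ring
        _ = (Real.sqrt (2 * CR) * T) ^ 2 := by
            rw [mul_pow, Real.sq_sqrt (by positivity)]
    exact le_of_pow_le_pow_left₀ two_ne_zero (by positivity) hsq
  linarith [hM'inc, hloss, hmain']

end Literature.Combinatorics.Additive
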